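import Summits.HodgeConjecture.HodgeConjecture.Theorems.F0P3ArchIsotypicBlockOfGlobalizations   -- ★ (A-p14 (g25)): `areUnitarilyEquivalent_restrict_of_descend`; brings FILE 3∕4∕5
import Literature.NumberTheory.Automorphic.HilbertRepAdmissibleDiscreteDecomposition             -- ★ (A-p14 (g25)): admissible ⇒ discretely decomposable
import Literature.NumberTheory.Automorphic.HilbertRepAdmissibleFiniteBlocks                      -- ★ (A-p14 (g25)): finitely many blocks of one class
import Literature.NumberTheory.Automorphic.HilbertRepOrthogonalDecomposition                     -- ★ `exists_orthogonalDecomposition_of_isDiscretelyDecomposable`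
import HarnessLib

/-!
# Crux `H413` — ROAD «TF», H3 (a) ⟸ {`K`-ADMISSIBILITY, CLASS ISOTYPY}: an admissible unitary representation of `G′_∞` all of whose irreducible blocks descend to
# globalizations of ONE class is a FINITE orthogonal sum of such blocks

Floor-0 programme P3, crux item stmt-HodgeConjecture-24833 (`HCCMUnconditional.H413`); ROAD «TF» (letter #84, registered residual `stub_AFS : ArchFinTraceSplit`), SPEC «J2» H3 (a)
in the J2 pen's block currency (F0P3a-p07 (g6) 00:14:57Z (3)): «∃ n (W : Fin n → ClosedSubrep π) (σ̄), pairwise ⟂ ∧ W i = σ̄ i ∘ archProjUForm ∧ IsUnitaryGlobalization x (σ̄ i) ∧ every vector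
lies in ⨆ W i».  Seat A-p14 (g25).  THEOREMS ONLY; `--supports stmt-HodgeConjecture-24833`.  HC_CM is proved only modulo the 2 remaining named inputs (hLiu418, h413) until rung 0 closes.

THE STATEMENT (`exists_fin_orthogonal_blocks_of_admissible_of_descend`).  Let `π` be a unitary strongly continuous representation of `G′_∞ = U(H)(L⁺ ⊗ ℝ)` on the Hilbert space
`E` (in J2: the `K′`-fixed block of `rep c` under `R ∘ archToAdelic`), `ιK : K →* G′_∞` a homomorphism from a compact Hausdorff group with `π ∘ ιK` strongly continuous
(`K_∞`), and `x` an irreducible `(𝔤, K)`-class of `U(2,1)`.  ASSUME (adm) `K`-ADMISSIBILITY: every irreducible `K`-type occurring in `E` has a finite-dimensional isotypic component;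
(iso) CLASS ISOTYPY WITH DESCENT: every irreducible closed `π`-invariant `W` factors through `archProjUForm` as `W.toContRep = σ̄ ∘ archProjUForm` with `σ̄` a unitary
globalization of `x` (print: F1a-type archimedean isotypy + «`Kc` acts trivially»).  THEN there are finitely many pairwise ORTHOGONAL irreducible closed invariant `W i`
(`i : Fin n`) with such descents `σ̄ i`, whose (algebraic) sum is ALL of `E`.
PROOF: ★ `IsUnitary.isDiscretelyDecomposable_of_finiteDimensional_homRangeSum` (HC Thm 4: admissible ⇒ discrete) + ★ `exists_orthogonalDecomposition_of_isDiscretelyDecomposable`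
give an orthogonal set `S` of irreducible blocks with dense sum; by (iso) and HARISH-CHANDRA'S THM 8 at `U(2,1)` (★ `areUnitarilyEquivalent_restrict_of_descend`) all members of
`S` are unitarily equivalent; ★ `ClosedSubrep.finite_of_areUnitarilyEquivalent` (finite multiplicity under admissibility, at a `K`-type `E₀` of one block, ★
`exists_finiteDimensional_stable_ne_bot` + ★ `exists_minimal_stable_submodule`) makes `S` FINITE; a finite orthogonal sum of closed subspaces is closed (it is the fixed
space of the sum of the orthogonal projections), hence equals its dense closure `E`.

* §1 `iSup_toSubmodule_eq_top_of_finite` — a FINITE pairwise orthogonal family of closed subspaces with dense sum has sum `⊤`.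
* §2 **`exists_fin_orthogonal_blocks_of_admissible_of_descend`**.

References: [HarishChandraTAMS1953] §9 Thm. 4 (p. 224), §11 Thm. 8 (p. 231); [Flath1979] Thm. 4; [BorelJacquet1979] §4.3, §4.6; [DeitmarEchterhoff2014] §7.3 Thm. 7.3.2.
-/

-- Mathlib idiom (as in ★ `GKModules`): commutator bracket, needed to MENTION `GKIrrClass (uFormGroup …)` ∕ `IsUnitaryGlobalization`.
attribute [local instance 100] LieRing.ofAssociativeRing

set_option autoImplicit false
-- the mandated namespace repeats `HodgeConjecture.HodgeConjecture`, as in every `Theorems/*.lean` of this sub-problem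
set_option linter.dupNamespace false

noncomputable section

open NumberField Topology Filter
open scoped InnerProductSpace Matrix MatrixGroups

namespace Summit.HodgeConjecture.HodgeConjecture.Cruxes.H413.F0P3ArchFixedBlockDecompositionOfAdmissible

open Literature.NumberTheory.Automorphic Literature.NumberTheory.Automorphic.UnitaryGroup
open Literature.RepresentationTheory Literature.RepresentationTheory.KonnoKonno2007 Literature.RepresentationTheory.KonnoKonno2007.RealDualPair
open Summit.HodgeConjecture.HodgeConjecture.Cruxes.H413.F0P3ArchIsotypicBlockOfGlobalizations (areUnitarilyEquivalent_restrict_of_descend)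
open ContRepresentation (AreUnitarilyEquivalent ClosedSubrep)

/-! ## §1 A finite orthogonal family of closed subspaces with dense sum sums to `⊤` -/

/-- **A FINITE pairwise orthogonal family of complete (closed) subspaces whose sum is dense has sum `⊤`**: the sum `M = ⨆ i, V i` is the fixed space of the continuous operator
`P = Σ i, p_{V i}` (on `V j` the other projections vanish), hence closed; closed and dense means everything. [folklore] [cite: DeitmarEchterhoff2014, §7.3 Thm. 7.3.2] -/
theorem iSup_eq_top_of_dense_of_orthogonal {E : Type*} [NormedAddCommGroup E] [InnerProductSpace ℂ E] [CompleteSpace E]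
    {ι : Type*} [Fintype ι] (V : ι → Submodule ℂ E) [∀ i, (V i).HasOrthogonalProjection]
    (ho : ∀ i j, i ≠ j → V i ⟂ V j) (hd : (⨆ i, V i).topologicalClosure = ⊤) : (⨆ i, V i) = ⊤ := by
  classical
  -- the operator `P = Σ p_{V i}` fixes `M = ⨆ V i` pointwise and has range inside `M`
  set P : E →L[ℂ] E := ∑ i, (V i).starProjection with hP
  have hPfix : ∀ v ∈ (⨆ i, V i), P v = v := by
    intro v hv
    induction hv using Submodule.iSup_induction' with
    | mem j v hvj =>
      rw [hP, FunLike.coe_sum, Finset.sum_apply, Finset.sum_eq_single j]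
      · exact (Submodule.starProjection_eq_self_iff).mpr hvj
      · intro i _ hij
        exact (Submodule.starProjection_apply_eq_zero_iff (V i)).mpr ((Submodule.isOrtho_iff_le).mp (ho j i (Ne.symm hij)) hvj)
      · intro h; exact absurd (Finset.mem_univ j) h
    | zero => rw [map_zero]
    | add v w _ _ hv hw => rw [map_add, hv, hw]
  have hPmem : ∀ v, P v ∈ (⨆ i, V i) := fun v => by
    rw [hP, FunLike.coe_sum, Finset.sum_apply]
    exact Submodule.sum_mem _ fun i _ => Submodule.mem_iSup_of_mem i ((V i).starProjection_apply_mem v)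
  -- `M` is the fixed space of `P`, hence closed
  have hM : ((⨆ i, V i : Submodule ℂ E) : Set E) = {v | P v = v} := by
    ext v
    exact ⟨fun hv => hPfix v hv, fun hv => by rw [Set.mem_setOf_eq] at hv; rw [← hv]; exact hPmem v⟩
  have hclosed : IsClosed ((⨆ i, V i : Submodule ℂ E) : Set E) := by
    rw [hM]
    exact isClosed_eq P.continuous continuous_id
  have h := (⨆ i, V i).topologicalClosure_coe
  rw [hclosed.closure_eq] at h
  have hcl : (⨆ i, V i).topologicalClosure = ⨆ i, V i := SetLike.coe_injective h
  rw [← hcl, hd]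

/-! ## §2 The finite orthogonal block decomposition -/

variable (L : Type) [Field L] [NumberField L] [IsCMField L] (ι : L →+* ℂ) (H : Matrix (Fin 3) (Fin 3) L) (T : GL (Fin 3) ℂ)
  (hT : (T : Matrix (Fin 3) (Fin 3) ℂ)ᴴ * H.map ι * (T : Matrix (Fin 3) (Fin 3) ℂ) = Literature.Geometry.ComplexHyperbolic.BallModel.J)

/-- **H3 (a) FROM `K`-ADMISSIBILITY AND CLASS ISOTYPY.**  `π` unitary strongly continuous on `E` (a representation of `G′_∞`), `ιK : K →* G′_∞` from a compact Hausdorff group with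
`π ∘ ιK` strongly continuous; (adm) every occurring irreducible `K`-type has a finite-dimensional isotypic component; (iso) every irreducible closed invariant `W` factors as
`W.toContRep = σ̄ ∘ archProjUForm` with `σ̄` a unitary globalization of the class `x`.  THEN `E` is the sum of FINITELY MANY pairwise orthogonal irreducible closed invariant
subspaces `W i`, each with such a descent `σ̄ i`. [cite: HarishChandraTAMS1953, §9 Thm. 4 (p. 224), §11 Thm. 8 (p. 231)] [cite: BorelJacquet1979, §4.6] [cite: DeitmarEchterhoff2014, §7.3 Thm. 7.3.2] -/
theorem exists_fin_orthogonal_blocks_of_admissible_of_descend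
    {x : GKIrrClass (uFormGroup (Fin 2) (Fin 1))}
    {E : Type} [NormedAddCommGroup E] [InnerProductSpace ℂ E] [CompleteSpace E]
    {π : ContRepresentation ℂ (arch (↥(maximalRealSubfield L)) L (IsCMField.complexConj L) 3 H) E} (hu : π.IsUnitary)
    {K : Type*} [Group K] [TopologicalSpace K] [IsTopologicalGroup K] [CompactSpace K] [T2Space K]
    (ιK : K →* arch (↥(maximalRealSubfield L)) L (IsCMField.complexConj L) 3 H) (hcK : (π.restrict ιK).IsStronglyContinuous)
    (hadm : ∀ (F : Submodule ℂ E) (hF : ∀ k, ∀ v ∈ F, (π.restrict ιK) k v ∈ F), FiniteDimensional ℂ F →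
      ((π.restrict ιK).subRep F hF).IsIrreducible →
      FiniteDimensional ℂ (Representation.homRangeSum (π.restrict ιK).toRepresentation ((π.restrict ιK).subRep F hF)))
    (hiso : ∀ W : ClosedSubrep π, W.toContRep.IsTopIrreducible →
      ∃ σbar : ContRepresentation ℂ (uFormGroup (Fin 2) (Fin 1)).carrier W.toSubmodule,
        (∀ g, W.toContRep g = σbar (archProjUForm L ι H T hT g)) ∧ IsUnitaryGlobalization (uFormGroup (Fin 2) (Fin 1)) x σbar) :
    ∃ (n : ℕ) (W : Fin n → ClosedSubrep π) (σbar : ∀ i, ContRepresentation ℂ (uFormGroup (Fin 2) (Fin 1)).carrier (W i).toSubmodule),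
      (∀ i j, i ≠ j → (W i).toSubmodule ⟂ (W j).toSubmodule) ∧ (∀ i, (W i).toContRep.IsTopIrreducible) ∧
      (∀ i g, (W i).toContRep g = σbar i (archProjUForm L ι H T hT g)) ∧
      (∀ i, IsUnitaryGlobalization (uFormGroup (Fin 2) (Fin 1)) x (σbar i)) ∧ (⨆ i, (W i).toSubmodule) = ⊤ := by
  classical
  -- discrete decomposition from admissibility
  have hd := hu.isDiscretelyDecomposable_of_finiteDimensional_homRangeSum ιK hcK hadm
  obtain ⟨S, hSirr, hSorth, hStop⟩ := hu.exists_orthogonalDecomposition_of_isDiscretelyDecomposable hd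
  -- descents of the members of `S`
  choose σb hσb hxb using fun W (hW : W ∈ S) => hiso W (hSirr W hW)
  -- all members of `S` are unitarily equivalent (Harish-Chandra Thm 8 at `U(2,1)`)
  have hequiv : ∀ W₀ ∈ S, ∀ W ∈ S, AreUnitarilyEquivalent W₀.toContRep W.toContRep := by
    intro W₀ hW₀ W hW
    have h1 : AreUnitarilyEquivalent ((σb W₀ hW₀).restrict (archProjUForm L ι H T hT)) W.toContRep :=
      areUnitarilyEquivalent_restrict_of_descend L ι H T hT (hxb W₀ hW₀) W.toContRep (hσb W hW) (hxb W hW)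
    have h0 : AreUnitarilyEquivalent ((σb W₀ hW₀).restrict (archProjUForm L ι H T hT)) W₀.toContRep :=
      areUnitarilyEquivalent_restrict_of_descend L ι H T hT (hxb W₀ hW₀) W₀.toContRep (hσb W₀ hW₀) (hxb W₀ hW₀)
    exact h0.symm.trans h1
  -- `S` is finite
  have hSfin : S.Finite := by
    by_cases hS : S = ∅
    · rw [hS]; exact Set.finite_empty
    obtain ⟨W₀, hW₀⟩ := Set.nonempty_iff_ne_empty.mpr hS
    -- a `K`-type of `W₀`: a minimal (irreducible) finite-dimensional stable `E₀ ≤ W₀`, `E₀ ≠ ⊥`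
    obtain ⟨F₀, hF₀W, hF₀K, hF₀fd, hF₀ne⟩ := ClosedSubrep.exists_finiteDimensional_stable_ne_bot ιK hu hcK W₀
      (ClosedSubrep.ne_bot_of_isTopIrreducible (hSirr W₀ hW₀))
    haveI := hF₀fd
    obtain ⟨E₀, hE₀F, hE₀ne, hE₀K, hE₀min⟩ :=
      exists_minimal_stable_submodule (ContRepresentation.toRepresentation ℂ K E (π.restrict ιK)) F₀ hF₀ne (fun k w hw ↦ hF₀K k w hw)
    haveI : FiniteDimensional ℂ E₀ := Submodule.finiteDimensional_of_le hE₀F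
    have hirr₀ : ((π.restrict ιK).subRep E₀ hE₀K).IsIrreducible :=
      ContRepresentation.isIrreducible_subRep_of_minimal hE₀K hE₀ne fun U hU hUle ↦ hE₀min U hU hUle
    haveI := hadm E₀ hE₀K inferInstance hirr₀
    exact (ClosedSubrep.finite_of_areUnitarilyEquivalent ιK W₀ (S := S) (fun W hW => hequiv W₀ hW₀ W hW) hSorth E₀ (hE₀F.trans hF₀W)
      hE₀K hE₀ne).1
  -- index by `Fin n`
  haveI : Finite S := hSfin.to_subtype
  obtain ⟨n, ⟨eqv⟩⟩ := Finite.exists_equiv_fin S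
  let W : Fin n → ClosedSubrep π := fun i => (eqv.symm i).1
  have hWmem : ∀ i, W i ∈ S := fun i => (eqv.symm i).2
  have hWinj : Function.Injective W := fun i j h => eqv.symm.injective (Subtype.ext h)
  refine ⟨n, W, fun i => σb (W i) (hWmem i), fun i j hij => hSorth (hWmem i) (hWmem j) (fun h => hij (hWinj h)),
    fun i => hSirr _ (hWmem i), fun i g => hσb _ (hWmem i) g, fun i => hxb _ (hWmem i), ?_⟩
  -- the finite orthogonal sum is everything
  have hsup : (⨆ i, (W i).toSubmodule) = ⨆ W' ∈ S, (W' : ClosedSubrep π).toSubmodule := by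
    apply le_antisymm
    · exact iSup_le fun i => le_iSup₂_of_le (W i) (hWmem i) le_rfl
    · refine iSup₂_le fun W' hW' => ?_
      have : W' = W (eqv ⟨W', hW'⟩) := by
        change W' = (eqv.symm (eqv ⟨W', hW'⟩)).1
        rw [Equiv.symm_apply_apply]
      rw [this]
      exact le_iSup (fun i => (W i).toSubmodule) _
  have hdense : (⨆ i, (W i).toSubmodule).topologicalClosure = ⊤ := by
    rw [hsup, Submodule.topologicalClosure_eq_top_iff]
    exact (ClosedSubrep.iSupClosure_eq_top_iff S).mp hStop
  exact iSup_eq_top_of_dense_of_orthogonal (fun i => (W i).toSubmodule) (fun i j hij => hSorth (hWmem i) (hWmem j) (fun h => hij (hWinj h))) hdense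

end Summit.HodgeConjecture.HodgeConjecture.Cruxes.H413.F0P3ArchFixedBlockDecompositionOfAdmissible

end
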